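import Summits.CriticalPhenomena.PercolationContinuityZ3.Theorems.Transplant.SkelPhiCorridorKGYRoute
import HarnessLib

/-!
# N2 (frames-only node `SamePDropOfSkeletonFrm₁`, OPEN), (C)/(R) columns, J16/J17 REPAIR: THE REGIONS OF THE SECOND-AXIS K-G CORRIDOR AS EXPLICIT BOXES,
# ONE PER STEP — `Skelφ.kgCorrSchedY_region_run_box` / `_park₁_box` / `_park₂_box`

The second-axis corridor `kgCorrSchedY` (y′-run of `N+1` hops drifting by `v` per hop in `x′`, then x-parking about `x′ = (N+1)v`, then y′-parking) read
in the x-run frame `(x′, row)`: region `k` of the run phase is the box `x′ ∈ [k·v − (n+v)⁺ − W − (k+1)R′ − n, k·v + (n−v)⁺ + W + (k+1)R′ + n]`,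
`row ∈ [k·sLo − q − (k+1)R′ − L, k·sHi + q + (k+1)R′ + L]` (`L := ⌊3nℓ/U⌋ + 1`; the cores STRETCH by `k·(sHi − sLo) + 2k·R′`); the parking regions sit
at rows `≥ (N+1)·sLo − O(q + (N+1)R′ + (m₁+1)(R′+ρ) + P + L)` and columns `(N+1)·v + O(·)`. These per-step boxes are what the seed clearance of the
(R) second-axis root leg ((R-38), J16) and the per-region habitat/reading rows of the (C) second axis ((R-39), J17: the union-prism schedule
`kgCorrSchedYU`) consume — the axis-parallel box around the WHOLE slanted prism (`mem_kgCorrSchedY_prism_box`) is `(N+2)|v|` wide and unusable.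
builds on p205010 (kernel theorem, internal audit signed; external expert review pending) — nothing in this file uses p205010; nothing here is a claim
about the open node `SamePDropOfSkeletonFrm₁`.
Lane `prim-bschramm`, seat `prim-bschramm-p5` (gen 16; (C) lineage); helper file (`--supports stmt-CriticalPhenomena-4575 --as helper`).
[cite: KozmaNitzan2024, §4 Lemma 11 (p. 22: the slabs of Ω), Lemma 12 (pp. 23–25)] [cite: MartineauTassion2017, §4.3 Lemma 4.2]
-/

noncomputable section

open scoped Classical

namespace Summit.CriticalPhenomena.PercolationContinuityZ3.Theorems.Transplant

namespace Skelφ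

open Literature.Probability.Percolation Literature.Probability.LatticeModels SimpleGraph
open Literature.Probability.Percolation.KozmaNitzan.Cells (oth)
open ChainPlanar ChainPara

variable {V : Type}

section KG

variable {n ℓ : ℕ} {h v : ℤ} {R' ρ q W N m₁ Wm₂ Wp₂ m₂ : ℕ} (hn : 1 ≤ n) (hv : |v| ≤ n) (hlay : (n + h.natAbs : ℕ) ≤ (n : ℤ) * ℓ + 1)
  (hP₁ : ParkOK (kgPark₁Y n ℓ h v R' ρ q W N m₁)) (hP₂ : ParkOK (kgPark₂Y n ℓ h v R' ρ q W N m₁ Wm₂ Wp₂ m₂))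
  (hsplit : (Wm₂ : ℤ) + Wp₂ = (kgPark₁Y n ℓ h v R' ρ q W N m₁).aHi (m₁ + 1) - ParkPrm.aLo (kgPark₁Y n ℓ h v R' ρ q W N m₁) (m₁ + 1))

include hn hv hlay hP₁ hP₂ hsplit in
/-- **RUN-PHASE REGION `k ≤ N` AS A BOX**: rows in `[k·sLo − q − (k+1)R′ − L, k·sHi + q + (k+1)R′ + L]`, columns in
`[k·v − (n+v)⁺ − W − (k+1)R′ − n, k·v + (n−v)⁺ + W + (k+1)R′ + n]`. [cite: KozmaNitzan2024, §4 Lemma 11 (p. 22)] -/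
theorem kgCorrSchedY_region_run_box {k : ℕ} (hk : k ≤ N) {y : Site 2} (hy : y ∈ (kgCorrSchedY hn hv hlay hP₁ hP₂ hsplit).region k) :
    (k : ℤ) * (((n : ℤ) * ℓ - (shearUnit n h : ℕ) + 1) / (shearUnit n h : ℕ)) - q - ((k : ℤ) + 1) * R' - ((3 * (n * ℓ) / shearUnit n h + 1 : ℕ) : ℤ) ≤ y 1 ∧
    y 1 ≤ (k : ℤ) * ((n : ℤ) * ℓ / (shearUnit n h : ℕ) + 1) + q + ((k : ℤ) + 1) * R' + ((3 * (n * ℓ) / shearUnit n h + 1 : ℕ) : ℤ) ∧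
    (k : ℤ) * v - (((n + v).toNat + W : ℕ) : ℤ) - ((k : ℤ) + 1) * R' - n ≤ y 0 ∧
    y 0 ≤ (k : ℤ) * v + (((n - v).toNat + W : ℕ) : ℤ) + ((k : ℤ) + 1) * R' + n := by
  obtain ⟨hreg, -, -⟩ := kgCorrSchedY_run_view hn hv hlay hP₁ hP₂ hsplit hk
  rw [hreg] at hy
  obtain ⟨h1, h2, h3, h4⟩ := (mem_yRunB_region_iff hn hv hlay R' q W N).1 hy
  simp only [RunPrm.aLo, RunPrm.aHi, RunPrm.bLo, RunPrm.bHi, yRunPrmB, yPrmW] at h1 h2 h3 h4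
  push_cast at h1 h2 h3 h4 ⊢
  refine ⟨by linarith, by linarith, by linarith, by linarith⟩

include hn hv hlay hP₁ hP₂ hsplit in
/-- **ACROSS-PARKING REGION `N+1+j` (`j ≤ m₁`) AS A BOX**: rows in `(N+1)·sLo + [−(q + (N+1)R′) − j(R′+ρ) − R′ − L, q + (N+1)R′ + (N+1)dS + j(R′+ρ) + R′ + L]`,
columns in `(N+1)·v + [−A₁Y⁻ − 2n − R′, A₁Y⁺ + j(R′+ρ) + R′ + n]`. [cite: KozmaNitzan2024, §4 Lemma 12 (pp. 23–25)] -/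
theorem kgCorrSchedY_region_park₁_box {j : ℕ} (hj : j ≤ m₁) {y : Site 2} (hy : y ∈ (kgCorrSchedY hn hv hlay hP₁ hP₂ hsplit).region (N + 1 + j)) :
    ((N : ℤ) + 1) * (((n : ℤ) * ℓ - (shearUnit n h : ℕ) + 1) / (shearUnit n h : ℕ)) - ((q : ℤ) + (N + 1) * R') - (j : ℤ) * (R' + ρ) - R' -
        ((3 * (n * ℓ) / shearUnit n h + 1 : ℕ) : ℤ) ≤ y 1 ∧
    y 1 ≤ ((N : ℤ) + 1) * (((n : ℤ) * ℓ - (shearUnit n h : ℕ) + 1) / (shearUnit n h : ℕ)) + ((q : ℤ) + (N + 1) * R' + (N + 1) * (dS n ℓ h : ℕ)) +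
        (j : ℤ) * (R' + ρ) + R' + ((3 * (n * ℓ) / shearUnit n h + 1 : ℕ) : ℤ) ∧
    ((N : ℤ) + 1) * v - (kgA₁Ym n v R' W N : ℕ) - 2 * n - R' ≤ y 0 ∧
    y 0 ≤ ((N : ℤ) + 1) * v + (kgA₁Yp n v R' W N : ℕ) + (j : ℤ) * (R' + ρ) + R' + n := by
  obtain ⟨hreg, -, -⟩ := kgCorrSchedY_park₁_view hn hv hlay hP₁ hP₂ hsplit hj
  rw [hreg] at hy
  obtain ⟨h1, h2, h3, h4⟩ := (mem_xParkC_region_iff hP₁ (kgC₁Y n ℓ h v N)).1 hy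
  have hbot : (xParkPrmW n ℓ h R' ρ (-((kgA₁Ym n v R' W N : ℕ) : ℤ)) (kgA₁Yp n v R' W N) (q + (N + 1) * R') (q + (N + 1) * R' + (N + 1) * dS n ℓ h) m₁).aBot ≤
      ParkPrm.aLo (xParkPrmW n ℓ h R' ρ (-((kgA₁Ym n v R' W N : ℕ) : ℤ)) (kgA₁Yp n v R' W N) (q + (N + 1) * R') (q + (N + 1) * R' + (N + 1) * dS n ℓ h) m₁) j :=
    ParkPrm.aBot_le_aLo hP₁ j
  have hbot' : -((kgA₁Ym n v R' W N : ℕ) : ℤ) - n ≤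
      (xParkPrmW n ℓ h R' ρ (-((kgA₁Ym n v R' W N : ℕ) : ℤ)) (kgA₁Yp n v R' W N) (q + (N + 1) * R') (q + (N + 1) * R' + (N + 1) * dS n ℓ h) m₁).aBot := by
    simp only [ParkPrm.aBot, xParkPrmW]
    rcases le_total (-((kgA₁Ym n v R' W N : ℕ) : ℤ)) (((kgA₁Yp n v R' W N : ℕ) : ℤ) + 1 - (n : ℕ)) with hc | hc
    · rw [min_eq_left hc]; have : (0 : ℤ) ≤ n := by positivity
      linarith
    · rw [min_eq_right hc]; have : (0 : ℤ) ≤ (kgA₁Yp n v R' W N : ℕ) := by positivity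
      linarith
  have hg : ((xParkPrmW n ℓ h R' ρ (-((kgA₁Ym n v R' W N : ℕ) : ℤ)) (kgA₁Yp n v R' W N) (q + (N + 1) * R') (q + (N + 1) * R' + (N + 1) * dS n ℓ h) m₁).g : ℤ) =
      R' + ρ := by rw [ParkPrm.g_eq]; simp [xParkPrmW]
  have hc0 : kgC₁Y n ℓ h v N 0 = ((N : ℤ) + 1) * v := by simp [kgC₁Y]
  have hc1 : kgC₁Y n ℓ h v N 1 = ((N : ℤ) + 1) * (((n : ℤ) * ℓ - (shearUnit n h : ℕ) + 1) / (shearUnit n h : ℕ)) := by simp [kgC₁Y]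
  simp only [ParkPrm.aHi, ParkPrm.bLo, ParkPrm.bHi] at h2 h3 h4
  rw [hg] at h3 h4
  rw [hc0] at h1 h2; rw [hc1] at h3 h4
  simp only [xParkPrmW] at h1 h2 h3 h4 hbot hbot'
  push_cast at h1 h2 h3 h4 hbot hbot' ⊢
  have hj0 : (0 : ℤ) ≤ (j : ℤ) * (R' + ρ) := by positivity
  refine ⟨by linarith, by linarith, by linarith, by linarith⟩

include hn hv hlay hP₁ hP₂ hsplit in
/-- **ALONG-PARKING REGION `N+1+m₁+1+j` AS A BOX** (rows ahead of the start, columns about `kgC₂Y … 0`): rows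
`≥ (N+1)·sLo − (q + (N+1)R′) − (m₁+1)(R′+ρ) − P − R′ − L` and `≤ (N+1)·sLo + q + (N+1)(R′+dS) + (m₁+1+j)(R′+ρ) + R′ + L`; columns in
`kgC₂Y … 0 + [−Wm₂ − j(R′+ρ+|v|) − R′ − n, Wp₂ + j(R′+ρ+|v|) + R′ + n]`. [cite: KozmaNitzan2024, §4 Lemma 12 (pp. 23–25)] -/
theorem kgCorrSchedY_region_park₂_box (j : ℕ) {y : Site 2} (hy : y ∈ (kgCorrSchedY hn hv hlay hP₁ hP₂ hsplit).region (N + 1 + m₁ + 1 + j)) :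
    ((N : ℤ) + 1) * (((n : ℤ) * ℓ - (shearUnit n h : ℕ) + 1) / (shearUnit n h : ℕ)) - ((q : ℤ) + (N + 1) * R') - ((m₁ : ℤ) + 1) * (R' + ρ) -
        ((n : ℤ) * ℓ / (shearUnit n h : ℕ) + 1) - R' - ((3 * (n * ℓ) / shearUnit n h + 1 : ℕ) : ℤ) ≤ y 1 ∧
    y 1 ≤ ((N : ℤ) + 1) * (((n : ℤ) * ℓ - (shearUnit n h : ℕ) + 1) / (shearUnit n h : ℕ)) + ((q : ℤ) + (N + 1) * R' + (N + 1) * (dS n ℓ h : ℕ)) +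
        ((m₁ : ℤ) + 1) * (R' + ρ) + (j : ℤ) * (R' + ρ) + R' + ((3 * (n * ℓ) / shearUnit n h + 1 : ℕ) : ℤ) ∧
    kgC₂Y n ℓ h v R' ρ q W N m₁ Wp₂ 0 - Wm₂ - (j : ℤ) * (R' + ρ + |v|) - R' - n ≤ y 0 ∧
    y 0 ≤ kgC₂Y n ℓ h v R' ρ q W N m₁ Wp₂ 0 + Wp₂ + (j : ℤ) * (R' + ρ + |v|) + R' + n := by
  have hg₁ : ((kgPark₁Y n ℓ h v R' ρ q W N m₁).g : ℤ) = R' + ρ := by rw [ParkPrm.g_eq]; simp [kgPark₁Y, xParkPrmW]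
  have hbLo : (kgPark₁Y n ℓ h v R' ρ q W N m₁).bLo (m₁ + 1) = -((q : ℤ) + (N + 1) * R') - ((m₁ : ℤ) + 1) * (R' + ρ) := by
    simp only [ParkPrm.bLo]; push_cast; rw [hg₁]; simp [kgPark₁Y, xParkPrmW]
  have hbHi : (kgPark₁Y n ℓ h v R' ρ q W N m₁).bHi (m₁ + 1) = (q : ℤ) + (N + 1) * R' + (N + 1) * (dS n ℓ h : ℕ) + ((m₁ : ℤ) + 1) * (R' + ρ) := by
    simp only [ParkPrm.bHi]; push_cast; rw [hg₁]; simp [kgPark₁Y, xParkPrmW]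
  set a0 := (kgPark₁Y n ℓ h v R' ρ q W N m₁).bLo (m₁ + 1) with ha0def
  set A0 := (kgPark₁Y n ℓ h v R' ρ q W N m₁).bHi (m₁ + 1) with hA0def
  obtain ⟨hreg, -, -⟩ := kgCorrSchedY_park₂_view hn hv hlay hP₁ hP₂ hsplit j
  rw [hreg] at hy
  obtain ⟨h1, h2, h3, h4⟩ := (mem_yParkC_region_iff hP₂ (kgC₂Y n ℓ h v R' ρ q W N m₁ Wp₂)).1 hy
  rw [← ha0def, ← hA0def] at h1 h2 h3 h4
  have hg₂ : ((yParkPrmW n ℓ h v R' ρ a0 A0 Wm₂ Wp₂ m₂).g : ℤ) =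
      R' + ρ + |v| := by rw [ParkPrm.g_eq]; simp [yParkPrmW]
  have hbot : (yParkPrmW n ℓ h v R' ρ a0 A0 Wm₂ Wp₂ m₂).aBot ≤
      ParkPrm.aLo (yParkPrmW n ℓ h v R' ρ a0 A0 Wm₂ Wp₂ m₂) j :=
    ParkPrm.aBot_le_aLo hP₂ j
  have hbot' : -((q : ℤ) + (N + 1) * R') - ((m₁ : ℤ) + 1) * (R' + ρ) - ((n : ℤ) * ℓ / (shearUnit n h : ℕ) + 1) ≤
      (yParkPrmW n ℓ h v R' ρ a0 A0 Wm₂ Wp₂ m₂).aBot := by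
    simp only [ParkPrm.aBot, yParkPrmW]
    rw [hbLo, hbHi]
    rcases le_total (-((q : ℤ) + (N + 1) * R') - ((m₁ : ℤ) + 1) * (R' + ρ))
        ((q : ℤ) + (N + 1) * R' + (N + 1) * (dS n ℓ h : ℕ) + ((m₁ : ℤ) + 1) * (R' + ρ) + 1 - ((n : ℤ) * ℓ / (shearUnit n h : ℕ) + 1)) with hc | hc
    · rw [min_eq_left hc]
      have : (0 : ℤ) ≤ (n : ℤ) * ℓ / (shearUnit n h : ℕ) := Int.ediv_nonneg (by positivity) (by positivity)
      linarith
    · rw [min_eq_right hc]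
      have : (0 : ℤ) ≤ q := by positivity
      have : (0 : ℤ) ≤ ((N : ℤ) + 1) * R' := by positivity
      have : (0 : ℤ) ≤ ((N : ℤ) + 1) * (dS n ℓ h : ℕ) := by positivity
      have : (0 : ℤ) ≤ ((m₁ : ℤ) + 1) * (R' + ρ) := by positivity
      linarith
  have hc1 : kgC₂Y n ℓ h v R' ρ q W N m₁ Wp₂ 1 = ((N : ℤ) + 1) * (((n : ℤ) * ℓ - (shearUnit n h : ℕ) + 1) / (shearUnit n h : ℕ)) := by simp [kgC₂Y]
  simp only [ParkPrm.aHi, ParkPrm.bLo, ParkPrm.bHi] at h2 h3 h4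
  rw [hg₂] at h3 h4
  rw [hc1] at h1 h2
  have hea : ((yParkPrmW n ℓ h v R' ρ a0 A0 Wm₂ Wp₂ m₂).ea : ℤ) =
      R' := by simp [yParkPrmW]
  have hLa : ((yParkPrmW n ℓ h v R' ρ a0 A0 Wm₂ Wp₂ m₂).La : ℤ) =
      ((3 * (n * ℓ) / shearUnit n h + 1 : ℕ) : ℤ) := by simp [yParkPrmW]
  have hA : (yParkPrmW n ℓ h v R' ρ a0 A0 Wm₂ Wp₂ m₂).A =
      (q : ℤ) + (N + 1) * R' + (N + 1) * (dS n ℓ h : ℕ) + ((m₁ : ℤ) + 1) * (R' + ρ) := by show A0 = _; exact hbHi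
  have hρ' : ((yParkPrmW n ℓ h v R' ρ a0 A0 Wm₂ Wp₂ m₂).ρ : ℤ) =
      ρ := by simp [yParkPrmW]
  rw [hea, hLa] at h1 h2
  rw [hA, hρ'] at h2
  have heb : ((yParkPrmW n ℓ h v R' ρ a0 A0 Wm₂ Wp₂ m₂).eb : ℤ) =
      R' := by simp [yParkPrmW]
  have hLb : ((yParkPrmW n ℓ h v R' ρ a0 A0 Wm₂ Wp₂ m₂).Lb : ℤ) =
      n := by simp [yParkPrmW]
  have hWm : ((yParkPrmW n ℓ h v R' ρ a0 A0 Wm₂ Wp₂ m₂).Wm : ℤ) =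
      Wm₂ := by simp [yParkPrmW]
  have hWp : ((yParkPrmW n ℓ h v R' ρ a0 A0 Wm₂ Wp₂ m₂).Wp : ℤ) =
      Wp₂ := by simp [yParkPrmW]
  rw [heb, hLb] at h3 h4
  rw [hWm] at h3; rw [hWp] at h4
  have hj0 : (0 : ℤ) ≤ (j : ℤ) * (R' + ρ) := by positivity
  refine ⟨by linarith, by linarith, by linarith, by linarith⟩

end KG

end Skelφ

end Summit.CriticalPhenomena.PercolationContinuityZ3.Theorems.Transplant

end
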